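import Mathlib
import HarnessLib
import Summits.HubbardSuperconductivity.HubbardSuperconductivity.Theorems.KLProgrammeKLRegimeEngineTowerWtReadoutFitSharp
import Summits.HubbardSuperconductivity.HubbardSuperconductivity.Theorems.KLProgrammeKLRegimeOverlapWtFlowAllUnif

/-!
# ♯4 RE-THREAD, FILE B («D-ORDER», located by p4 g22 KL STATUS l.11984, booked pen (R411)(C)/(R416)(B)(2)): THE WEIGHTED READ-OUT — PARTIAL INCREMENT (W7a)
# AND SHARP FIT (W7b♯) — WITH THE d-FREE CONSTANTS `Cκ CJ C₁′ C₂′` (and `C₁ C₂`) SEALED BEFORE `∀ d` (only the alpha constant `Cb` after it)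
# Route `KLProgramme` — crux K3 ENGINE (stmt-HubbardSuperconductivity-20437 `KLRegimeEngineV17F2`), stub (b) v2, THE WEIGHTED HALF «(b)-WT4»
# (cell gate-hubbard-kl, seat hubbard-kl-k3c3-p2 g18; ∃-rescoping twins of W7a `readoutWt_inc_le_kit_klEng` (…TowerWtReadoutInc, p701151) and W7b♯
#  `klWtPinnedSum_le_klWtBudget_of_wtLaw_klEng_sharp` (…TowerWtReadoutFitSharp, p706363) on `overlapWt_towerBlock_klEng_flow_all_unif`; bodies and proofs
#  verbatim, the intro of `d` moved after the d-free constants; E1 may rename or supersede)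

WHY.  See file A (…TowerWtLawOfBlocksKlEngUnif): the read-out's overlap constant `CJr` enters the numerics' pin `c̄c ≥ 162·CJr·M/β`, hence `Z` and the blocking
row `2^{d−1} ≥ 8e⁴·Z·C₂²`; it must therefore be sealed before the block length `d` is chosen.  In value only the alpha constant `Cb` of the read-out's partial
slice depends on `d` (`alphaWt_blockSliceCT_bgmFat_klEng_flow_all' d`); the Gram door, the uniform overlap door and the jump constants `C₁′ C₂′`
(`wtJump_readout_le_klEng R c″`) / `C₁ C₂` (`readoutWt_ro_le_profile_klEng R c″`) do not.
* §1 **`readoutWt_inc_le_kit_klEng_unif (R c″)`** — `∃ Cκ CJ C₁ C₂ > 0, ∀ d, ∃ Cb > 0, (R.WF2 → <body of readoutWt_inc_le_kit_klEng d R c″>)`;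
* §2 **`klWtPinnedSum_le_klWtBudget_of_wtLaw_klEng_sharp_unif (R c″)`** — `∃ C₁ C₂ Cκ CJ C₁′ C₂′ > 0, ∀ d, ∃ Cb > 0, (R.WF2 → <body of W7b♯>)`.
Compositions/re-scopings of landed theorems; nothing about the model is asserted beyond them; nothing asserts (b), (ℓ), any stub, K3 or superconductivity.
References: BGM 2006 §2.8 (2.76)–(2.84), (2.93)–(2.98), Lemma 2.5 (2.98), §3 (3.2)–(3.8) [cite: BenfattoGiulianiMastropietro2006].
-/

noncomputable section

namespace Summit.HubbardSuperconductivity.HubbardSuperconductivity.Theorems.EngineV8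

set_option linter.dupNamespace false -- summit = problem name (single-conjunct summit), D-0017

open Classical
open Real Finset Literature.MathematicalPhysics.QuantumLattice Literature.Probability.LatticeModels GrassmannAlgebra
open Literature.MathematicalPhysics.QuantumLattice.FermiRG Literature.MathematicalPhysics.QuantumLattice.FermiRG.BGM2006Routing
open Summit.HubbardSuperconductivity.HubbardSuperconductivity.Theorems.KLProgrammeLegKernels
open Summit.HubbardSuperconductivity.HubbardSuperconductivity.Theorems.KLRegimeSplit
open Summit.HubbardSuperconductivity.HubbardSuperconductivity.Theorems.KLRegimeWick
open Summit.HubbardSuperconductivity.HubbardSuperconductivity.Theorems.TwoPointAssembly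
open Summit.HubbardSuperconductivity.HubbardSuperconductivity.Theorems.DispersionFlow
open Summit.HubbardSuperconductivity.HubbardSuperconductivity.Theorems.TorusFourierL2

variable {L M : ℕ} [NeZero L] [NeZero M]

/-! ## §1 The partial increment under the law's kit bracket, with `∃ Cκ CJ C₁ C₂` before `∀ d` -/

/-- **d-UNIFORM form of W7a `readoutWt_inc_le_kit_klEng`** («D-ORDER» cure at the source): `∃ Cκ CJ C₁ C₂ > 0` (Gram door, UNIFORM overlap door, the
read-out jump's constants — all d-free) BEFORE `∀ d`, then `∃ Cb > 0` (the partial slice's alpha constant) and `R.WF2 → ∃ c₃′ U₀′`; body and proof those of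
`readoutWt_inc_le_kit_klEng`. [cite: BenfattoGiulianiMastropietro2006, §2.8 (2.76)-(2.84), (2.93)-(2.98), §3 (3.2)-(3.8)] -/
theorem readoutWt_inc_le_kit_klEng_unif (R : RenConsts) (c'' : ℝ) (hc'' : 0 < c'') :
    ∃ Cκ CJ C₁ C₂ : ℝ, 0 < Cκ ∧ 0 < CJ ∧ 0 < C₁ ∧ 0 < C₂ ∧ ∀ d : ℕ, ∃ Cb : ℝ, 0 < Cb ∧ (R.WF2 → ∃ c₃' : ℝ, 0 < c₃' ∧ ∃ U₀' : ℝ, 0 < U₀' ∧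
      ∀ (G : GeoConsts) (P : SplitConsts) (Q : EngConsts) (c : ℝ), P.WF → 0 < c → c ≤ klEngC₃6 P R → c ≤ c₃' →
      ∀ μ ∈ klWindowC, ∀ U : ℝ, 0 < U → U ≤ klEngU₀9 P R c → U ≤ U₀' → c'' * U ≤ 1 →
      ∀ β : ℝ, klBetaMin ≤ β → β ≤ Real.exp (c / U ^ 2) →
      ∀ (L M : ℕ) [NeZero L] [NeZero M], klEngL₃ β U ≤ L → klEngM₃ β U L ≤ M →
      ∀ n : ℕ, 1 ≤ n → n ≤ nScales β + 1 → IsKLRegime U c (-(n : ℤ)) → HistP klPredsV17F2 L M G P Q R β U μ 0 n →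
        (∀ m', 1 ≤ m' → m' < n → FlowPieceOscAt L M c'' β U μ m') →
      2 ≤ d → ∀ Kb j : ℕ, 1 ≤ Kb → d * Kb ≤ j → j ≤ n → j ≤ d * Kb + d →
      ∀ D : ℕ, Fintype.card (SpaceTimeIdx L M × SectorLeg (sectorCount (d * Kb - 1))) / 2 ≤ D →
      hubbardEffPartitionFnCT L M β U μ 0 (klFlowFrameU L M β U μ n) (klScale klE0 (d * Kb)) ≠ 0 →
      ∀ (κb αb crb ccb : ℝ), Real.sqrt (2 * Cκ * klE0) ≤ κb → Cb * ((M : ℝ) / β) * (4 : ℝ) ^ d / klE0 ≤ αb →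
        81 * CJ * M / β ≤ crb → 162 * CJ * M / β ≤ ccb →
      ∀ (W Z σ τ ψ Φ : ℝ),
        W = 32 * crb / ccb → Z = imagTimeWeight β M ^ 2 * ccb ^ 2 / 8 →
        σ = κb ^ 2 / ccb ^ 2 → τ = 4 * exp 4 * κb ^ 2 / ccb ^ 2 → ψ = ccb ^ 2 / κb ^ 2 → Φ = exp 1 * αb * ccb / (κb ^ 2 * crb) →
      ∀ N : ℕ, 1 ≤ N → ∀ q : ℕ, 2 ≤ q →
        Φ * towerV D τ (fun m => W * Z ^ m *
          (klTowerMeasWtAt L M β U μ (klFlowFrameU L M β U μ n) d Kb j (2 * m) / klLevUnitF β M 0 m (d * Kb - 1))) < 1 →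
        ∀ (i : Fin (2 * (q + 1))) (w : SpaceTimeIdx L M × SectorLeg (sectorCount j)),
        klWtPinnedSumAt L M β μ (klFlowFrameU L M β U μ n) j j (2 * (q + 1))
            (klEffectiveAction L M β U μ (klFlowFrameU L M β U μ n) klE0 j - klTowerInput L M β U μ (klFlowFrameU L M β U μ n) d Kb) i w /
            klLevUnitF β M 0 (q + 1) j ≤
          C₁ / C₂ * (max 1 (C₂ ^ 2)) ^ (q + 1) *
            (towerFO D σ (fun m => W * Z ^ m *
                (klTowerMeasWtAt L M β U μ (klFlowFrameU L M β U μ n) d Kb j (2 * m) / klLevUnitF β M 0 m (d * Kb - 1))) (q + 1) +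
              ∑ n' ∈ Icc 2 N, exp 1 * Φ ^ (n' - 1) * ψ ^ (q + 1) *
                towerS D τ (fun m => W * Z ^ m *
                  (klTowerMeasWtAt L M β U μ (klFlowFrameU L M β U μ n) d Kb j (2 * m) / klLevUnitF β M 0 m (d * Kb - 1))) n' (q + 1) +
              ψ ^ (q + 1) * exp 1 * towerV D τ (fun m => W * Z ^ m *
                  (klTowerMeasWtAt L M β U μ (klFlowFrameU L M β U μ n) d Kb j (2 * m) / klLevUnitF β M 0 m (d * Kb - 1))) *
                (Φ * towerV D τ (fun m => W * Z ^ m *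
                  (klTowerMeasWtAt L M β U μ (klFlowFrameU L M β U μ n) d Kb j (2 * m) / klLevUnitF β M 0 m (d * Kb - 1)))) ^ N /
                (1 - Φ * towerV D τ (fun m => W * Z ^ m *
                  (klTowerMeasWtAt L M β U μ (klFlowFrameU L M β U μ n) d Kb j (2 * m) / klLevUnitF β M 0 m (d * Kb - 1)))))) := by
  obtain ⟨Cκ, hCκ, hg⟩ := gram_sliceCT_bgmFat_sharp_klEng
  obtain ⟨CJ, hCJ, hop⟩ := overlapWt_towerBlock_klEng_flow_all_unif R c'' hc''.le
  obtain ⟨C₁, C₂, hC₁, hC₂, hjp⟩ := wtJump_readout_le_klEng R c'' hc''.le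
  refine ⟨Cκ, CJ, C₁, C₂, hCκ, hCJ, hC₁, hC₂, fun d => ?_⟩
  obtain ⟨Cb, hCb, hαp⟩ := alphaWt_blockSliceCT_bgmFat_klEng_flow_all' d R c'' hc''
  refine ⟨Cb, hCb, fun hR2 => ?_⟩
  obtain ⟨c₃, hc₃, U₀, hU₀, hjp'⟩ := hjp hR2
  refine ⟨c₃, hc₃, U₀, hU₀, ?_⟩
  intro G P Q c hP hc hc6 hc₃' μ hμ U hU hU9 hU₀' hcU β hβmin hβc L M _ _ hL3 hM3 n hn1 hnN hkl hhist hosc hd Kb j hKb1 hKbj hjn hjd D hD hZ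
    κb αb crb ccb hκb hαb hcrb hccb W Z σ τ ψ Φ hW hZ' hσ hτ hψ hΦ N hN q hq2 hguard i w
  have he : (0 : ℝ) < klE0 := by norm_num [klE0]
  have hβ : 0 < β := KLRegimeSplit.pos_of_klBetaMin_le hβmin
  have hM0 : (0 : ℝ) < M := Nat.cast_pos.2 (Nat.pos_of_ne_zero (NeZero.ne M))
  have hx : 0 < imagTimeWeight β M := imagTimeWeight_pos_of_pos (M := M) hβ
  have hfr : FrameOK R U (nScales β) μ (klFlowFrameU L M β U μ n) := frameOK_klFlowFrameU_of_histP_le hR2 hn1 le_rfl hnN hhist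
  have hU4 : U ≤ klEngU₀4 P R c := hU9.trans (klEngU₀9_le_klEngU₀4 P R c)
  have hU3g : U ≤ min (klEngU₀3 P R c) (1 / (R.Gfr 3 + 1)) :=
    le_min (hU9.trans (klEngU₀9_le_klEngU₀3 P R c)) (hU9.trans (klEngU₀9_le_inv_gfr_add_one P hR2.wf c (by norm_num)))
  have hc3 : c ≤ klEngC₃3 P R := hc6.trans (klEngC₃6_le_klEngC₃3 P R)
  set K : TrigPolyC4v := klFlowFrameU L M β U μ n with hKdef
  -- constants
  have hsq0 : 0 < Real.sqrt (2 * Cκ * klE0) := Real.sqrt_pos.2 (by positivity)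
  have hκb0 : 0 < κb := lt_of_lt_of_le hsq0 hκb
  have hαb0 : 0 < αb := lt_of_lt_of_le (by positivity) hαb
  have hcrb0 : 0 < crb := lt_of_lt_of_le (by positivity) hcrb
  have hccb0 : 0 < ccb := lt_of_lt_of_le (by positivity) hccb
  have hW0 : 0 < W := by rw [hW]; positivity
  have hZ0 : 0 < Z := by rw [hZ']; positivity
  have hσ0 : 0 ≤ σ := by rw [hσ]; positivity
  have hτ0 : 0 < τ := by rw [hτ]; positivity
  have hψ0 : 0 ≤ ψ := by rw [hψ]; positivity
  have hΦ0 : 0 ≤ Φ := by rw [hΦ]; positivity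
  have hdKb : 2 ≤ d * Kb := le_trans hd (Nat.le_mul_of_pos_right d hKb1)
  -- the kit bracket is nonnegative under the guard
  set μb : ℕ → ℝ := fun m => W * Z ^ m * (klTowerMeasWtAt L M β U μ K d Kb j (2 * m) / klLevUnitF β M 0 m (d * Kb - 1)) with hμb
  have hμb0 : ∀ m, 0 ≤ μb m := fun m => towerMuWt_nonneg hβ U μ K d Kb j m hW0.le hZ0.le
  have hV0 : 0 ≤ towerV D τ μb := towerV_nonneg hτ0.le hμb0
  have hkit0 : 0 ≤ towerFO D σ μb (q + 1) + ∑ n' ∈ Icc 2 N, exp 1 * Φ ^ (n' - 1) * ψ ^ (q + 1) * towerS D τ μb n' (q + 1) +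
      ψ ^ (q + 1) * exp 1 * towerV D τ μb * (Φ * towerV D τ μb) ^ N / (1 - Φ * towerV D τ μb) := by
    have h1 : 0 ≤ towerFO D σ μb (q + 1) := towerFO_nonneg hσ0 hμb0 _
    have h2 : 0 ≤ ∑ n' ∈ Icc 2 N, exp 1 * Φ ^ (n' - 1) * ψ ^ (q + 1) * towerS D τ μb n' (q + 1) :=
      sum_nonneg fun n' _ => mul_nonneg (mul_nonneg (mul_nonneg (exp_pos 1).le (pow_nonneg hΦ0 _)) (pow_nonneg hψ0 _))
        (towerS_nonneg hτ0.le hμb0 n' (q + 1))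
    have h3 : 0 ≤ ψ ^ (q + 1) * exp 1 * towerV D τ μb * (Φ * towerV D τ μb) ^ N / (1 - Φ * towerV D τ μb) :=
      div_nonneg (by positivity) (sub_nonneg.2 hguard.le)
    exact add_nonneg (add_nonneg h1 h2) h3
  have hCD0 : 0 ≤ C₁ / C₂ * (max 1 (C₂ ^ 2)) ^ (q + 1) := by positivity
  -- case `j = dK_b`: the increment vanishes
  rcases Nat.eq_or_lt_of_le hKbj with hjeq | hjlt
  · have h0 : klEffectiveAction L M β U μ K klE0 j - klTowerInput L M β U μ K d Kb = 0 := by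
      rw [← hjeq]; unfold klTowerInput; exact sub_self _
    rw [h0, klWtPinnedSumAt_zero_elem, zero_div]
    exact mul_nonneg hCD0 hkit0
  · -- case `dK_b < j`: born at `F_{dK_b}` (WB1 §4, data discharged), then one jump to `F_j`
    -- the partial slice's Gram constant
    have hΛpos : 0 < klScale klE0 j := klth_klScale_pos _
    have hΛle : klScale klE0 j ≤ klScale klE0 (d * Kb) := klScale_le_klScale he.le hKbj
    have hΛle' : klScale klE0 (d * Kb) ≤ klScale klE0 (d * Kb - 1) := klScale_le_klScale he.le (by omega)
    obtain ⟨m₀, hm₀⟩ : ∃ m₀, d * Kb - 1 = m₀ + 1 := ⟨d * Kb - 2, by omega⟩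
    have hgram := (hg P R c hP hR2 hc hc3 μ hμ U hU hU4 β hβmin hβc K hfr L M hL3 hM3 m₀ (by omega)
      (klScale klE0 j) (klScale klE0 (d * Kb)) hΛpos hΛle (by rw [← hm₀]; exact hΛle')).2.1
    rw [← hm₀] at hgram
    have hκpos : 0 < Real.sqrt (Cκ * (klScale klE0 (d * Kb) / klScale klE0 (d * Kb - 1)) * (klE0 * ((8 : ℝ) ^ (d * Kb - 1))⁻¹)) := by
      have h1 : 0 < klScale klE0 (d * Kb) := klth_klScale_pos _
      have h2 : 0 < klScale klE0 (d * Kb - 1) := klth_klScale_pos _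
      exact Real.sqrt_pos.2 (by positivity)
    have hκsq : Real.sqrt (Cκ * (klScale klE0 (d * Kb) / klScale klE0 (d * Kb - 1)) * (klE0 * ((8 : ℝ) ^ (d * Kb - 1))⁻¹)) ^ 2 *
        (8 : ℝ) ^ (d * Kb) ≤ κb ^ 2 := by
      rw [gramF_sq_mul_pow_eq hCκ.le (by omega)]; exact pow_le_pow_left₀ hsq0.le hκb 2
    -- the partial slice's weighted decay rows at rate `j`
    obtain ⟨hrow, hcol⟩ := hαp G P Q c hR2 hc hc6 μ hμ U hU hU3g hcU β hβmin hβc L M hL3 hM3 n hn1 hnN hkl hhist hosc (d * Kb - 1) (by omega) j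
      (by omega) (by omega) (by omega) j (by omega)
    have hαle : Cb * ((M : ℝ) / β) / klScale klE0 j ≤ αb * (4 : ℝ) ^ (d * Kb) :=
      (div_klScale_le_bound_mul_pow (by positivity) hjd).trans (mul_le_mul_of_nonneg_right hαb (by positivity))
    have hfam : d * Kb - 1 + 1 = d * Kb := by omega
    rw [hfam] at hrow hcol
    -- the analysis overlaps at the born family
    obtain ⟨hrow', hcol'⟩ := hop d G P Q c hR2 hc hc6 μ hμ U hU hU3g hcU β hβmin hβc L M hL3 hM3 n hn1 hnN hkl hhist hosc Kb (by omega) (by omega) j hKbj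
    have h2 : (2 : ℝ) ^ (d * Kb - (d * Kb - 1)) = 2 := by rw [show d * Kb - (d * Kb - 1) = 1 by omega, pow_one]
    have hcol'' : ∀ X', ∑ X'', ‖(sectorAnalysisMatrix L M β (klAnisoFamily L M β μ K klE0 (d * Kb)) *
        sectorSubMatrix L M β (bgmFatMultiplier L M klE0 β (nambuXiCT L μ K) (d * Kb - 1))) X'' X'‖ *
        klScaleWt L M β j {latticeLegPos (2 * (2 * M)) X'', latticeLegPos (2 * (2 * M)) X'} ≤ ccb := by
      intro X'
      have h := hcol' X'
      rw [h2] at h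
      exact h.trans ((le_of_eq (by ring)).trans hccb)
    -- WB1 §4 at the born family `F_{dK_b}`, every pin
    have hborn : ∀ (i' : Fin (2 * (q + 1))) (w'' : SpaceTimeIdx L M × SectorLeg (sectorCount (d * Kb))),
        klWtPinnedSumAt L M β μ K (d * Kb) j (2 * (q + 1)) (klEffectiveAction L M β U μ K klE0 j - klTowerInput L M β U μ K d Kb) i' w'' /
          klLevUnitF β M 0 (q + 1) (d * Kb) ≤
        towerFO D σ μb (q + 1) + ∑ n' ∈ Icc 2 N, exp 1 * Φ ^ (n' - 1) * ψ ^ (q + 1) * towerS D τ μb n' (q + 1) +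
          ψ ^ (q + 1) * exp 1 * towerV D τ μb * (Φ * towerV D τ μb) ^ N / (1 - Φ * towerV D τ μb) := by
      intro i' w''
      subst hW hZ' hσ hτ hψ hΦ
      exact klWtPinnedSumAt_partialIncr_le_kitStep_of_bounds (L := L) (M := M) hβ U μ K j (by omega) hKb1 le_rfl hKbj hZ hκpos hκb0 hκsq hgram
        hαb0 hαle hrow hcol hcrb0 hccb0 (fun X'' => (hrow' X'').trans hcrb) hcol'' hD hN hguard q i' w''
    -- one jump to `F_j`
    have hjump := hjp' G P Q c hc hc6 hc₃' μ hμ U hU hU3g hU₀' hcU β hβmin hβc L M hL3 hM3 n hn1 hnN hkl hhist hosc (d * Kb) j (by omega) hjn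
      (klEffectiveAction L M β U μ K klE0 j - klTowerInput L M β U μ K d Kb)
      (fun m' X hX => partialIncr_momentumConserving β U μ K d Kb j m' X hX) j le_rfl (q + 1) (by omega) _ hkit0 hborn i w
    refine hjump.trans (mul_le_mul_of_nonneg_right ?_ hkit0)
    exact mul_le_mul_of_nonneg_left (pow_le_pow_left₀ (sq_nonneg _) (le_max_right _ _) _) (by positivity)

/-! ## §2 The weighted clause at one read-out level from the weighted law (sharp bracket), with the d-free constants before `∀ d` -/

set_option maxHeartbeats 400000 in -- one ~120-binder composition of five landed theorems (as in W7b♯)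
/-- **d-UNIFORM form of W7b♯ `klWtPinnedSum_le_klWtBudget_of_wtLaw_klEng_sharp`** («D-ORDER» cure): `∃ C₁ C₂ Cκ CJ C₁′ C₂′ > 0` BEFORE `∀ d` (`C₁ C₂`
from W6 `readoutWt_ro_le_profile_klEng R c″`, `Cκ CJ C₁′ C₂′` from §1), then `∃ Cb > 0` and `R.WF2 → ∃ c₃′ U₀′`; the body (see W7b♯'s docstring: base rows,
law on the blocks `2 … K_b`, dominants, names, exported profile rows and imports at block `K_b`, five smallness rows, `A_tot Q_tot` SHARP, the `CE` threshold
⊢ `klWtPinnedSum … j (2p) q w ≤ klWtBudget P Qe U j (2p)` for `4 ≤ p ≤ D`) and the proof are W7b♯'s. [cite: BenfattoGiulianiMastropietro2006, §2.8 (2.93)-(2.98), Lemma 2.5 (2.98)] -/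
theorem klWtPinnedSum_le_klWtBudget_of_wtLaw_klEng_sharp_unif (R : RenConsts) (c'' : ℝ) (hc'' : 0 < c'') :
    ∃ C₁ C₂ Cκ CJ C₁' C₂' : ℝ, 0 < C₁ ∧ 0 < C₂ ∧ 0 < Cκ ∧ 0 < CJ ∧ 0 < C₁' ∧ 0 < C₂' ∧ ∀ d : ℕ, ∃ Cb : ℝ, 0 < Cb ∧
      (R.WF2 → ∃ c₃' : ℝ, 0 < c₃' ∧ ∃ U₀' : ℝ, 0 < U₀' ∧
      ∀ (G : GeoConsts) (P : SplitConsts) (Q : EngConsts) (c : ℝ), P.WF → 0 < c → c ≤ klEngC₃6 P R → c ≤ c₃' →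
      ∀ μ ∈ klWindowC, ∀ U : ℝ, 0 < U → U ≤ klEngU₀9 P R c → U ≤ U₀' → c'' * U ≤ 1 →
      ∀ β : ℝ, klBetaMin ≤ β → β ≤ Real.exp (c / U ^ 2) →
      ∀ (L M : ℕ) [NeZero L] [NeZero M], klEngL₃ β U ≤ L → klEngM₃ β U L ≤ M →
      ∀ n : ℕ, 1 ≤ n → n ≤ nScales β + 1 → IsKLRegime U c (-(n : ℤ)) → HistP klPredsV17F2 L M G P Q R β U μ 0 n →
        (∀ m', 1 ≤ m' → m' < n → FlowPieceOscAt L M c'' β U μ m') →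
      2 ≤ d → ∀ Kb j : ℕ, 1 ≤ Kb → d * Kb ≤ j → j ≤ n → j ≤ d * Kb + d →
      ∀ D : ℕ, 3 ≤ D → Fintype.card (SpaceTimeIdx L M × SectorLeg (sectorCount (d * Kb - 1))) / 2 ≤ D →
      hubbardEffPartitionFnCT L M β U μ 0 (klFlowFrameU L M β U μ n) (klScale klE0 (d * Kb)) ≠ 0 →
      ∀ (B A lam Q' Ab Qb : ℝ), 1 ≤ B → lam = B * epsCoupling P U j → 0 ≤ A → 0 < lam → 0 < Q' → 0 ≤ Ab → 0 ≤ Qb →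
      -- the base datum rows at `(F_{d−1}, rate j)`
      ∀ Nb : ℕ → ℝ, (∀ p, 0 ≤ Nb p) →
        (∀ (p : ℕ) (q : Fin (2 * p)) (w' : SpaceTimeIdx L M × SectorLeg (sectorCount (d - 1))),
          klWtPinnedSumAt L M β μ (klFlowFrameU L M β U μ n) (d - 1) j (2 * p) (klTowerInput L M β U μ (klFlowFrameU L M β U μ n) d 1) q w' ≤ Nb p) →
        (∀ p : ℕ, 3 ≤ p → Nb p / klLevUnitF β M 0 p (d - 1) ≤ Ab * lam ^ (p - 1) * Qb ^ p) →
      -- the weighted law on the born arrays of the blocks `2 … K_b` at rate `j`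
      (∀ k' : ℕ, 2 ≤ k' → k' ≤ Kb → ∀ p : ℕ, 3 ≤ p → p ≤ D →
        klTowerBornWtAt L M β U μ (klFlowFrameU L M β U μ n) d (k' - 1) j (2 * p) / klLevUnitF β M 0 p (d * (k' - 1)) ≤ A * lam ^ (p - 1) * Q' ^ p) →
      -- dominants of the read-out's constants and the names
      ∀ (κb αb crb ccb : ℝ), Real.sqrt (2 * Cκ * klE0) ≤ κb → Cb * ((M : ℝ) / β) * (4 : ℝ) ^ d / klE0 ≤ αb →
        81 * CJ * M / β ≤ crb → 162 * CJ * M / β ≤ ccb →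
      ∀ (W Z σ τ ψ Φ : ℝ),
        W = 32 * crb / ccb → Z = imagTimeWeight β M ^ 2 * ccb ^ 2 / 8 →
        σ = κb ^ 2 / ccb ^ 2 → τ = 4 * exp 4 * κb ^ 2 / ccb ^ 2 → ψ = ccb ^ 2 / κb ^ 2 → Φ = exp 1 * αb * ccb / (κb ^ 2 * crb) →
      -- the exported profile rows and the imports at block `K_b`
      ∀ (A'' Q'' ι₁ ι₂ ι₃ : ℝ), 0 ≤ A'' → 0 < Q'' →
      (∀ m, 4 ≤ m → m ≤ D → W * Z ^ m *
        (klTowerMeasWtAt L M β U μ (klFlowFrameU L M β U μ n) d Kb j (2 * m) / klLevUnitF β M 0 m (d * Kb - 1)) ≤ A'' * lam ^ (m - 1) * Q'' ^ m) →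
      W * Z ^ 1 * (klTowerMeasWtAt L M β U μ (klFlowFrameU L M β U μ n) d Kb j (2 * 1) / klLevUnitF β M 0 1 (d * Kb - 1)) ≤ ι₁ * lam →
      W * Z ^ 2 * (klTowerMeasWtAt L M β U μ (klFlowFrameU L M β U μ n) d Kb j (2 * 2) / klLevUnitF β M 0 2 (d * Kb - 1)) ≤ ι₂ * lam →
      W * Z ^ 3 * (klTowerMeasWtAt L M β U μ (klFlowFrameU L M β U μ n) d Kb j (2 * 3) / klLevUnitF β M 0 3 (d * Kb - 1)) ≤ ι₃ * lam ^ 2 →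
      -- the five smallness rows
      4 * σ * lam * Q'' < 1 → 2 * lam * τ * Q'' ≤ 1 → exp 1 * τ * lam * Q'' < 1 →
      Φ * (τ * (ι₁ * lam + ι₂ / (2 * Q'') + ι₃ / (4 * Q'' ^ 2) + A'' * Q'' / 4)) < 1 →
      Φ * (exp 1 * τ * (ι₁ * lam) + (exp 1 * τ) ^ 2 * (ι₂ * lam) + (exp 1 * τ) ^ 3 * (ι₃ * lam ^ 2) +
        A'' * (exp 1 * τ * Q'') * ((exp 1 * τ * lam * Q'') ^ 3 / (1 - exp 1 * τ * lam * Q''))) < 1 →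
      -- the read-out constants and the `CE` threshold
      ∀ (Atot Qtot : ℝ),
        Qtot = max 1 (C₂' ^ 2) * max 1 (max (C₂ ^ 2 * max Q' Qb) (max (4 * Q'') (2 * τ * ψ * Q''))) →
        Atot = C₁ / C₂ * (Ab + A) + C₁' / C₂' * (A'' * (4 * σ * lam * Q'' / (1 - 4 * σ * lam * Q'')) +
          exp 1 * (τ * (ι₁ * lam + ι₂ / (2 * Q'') + ι₃ / (4 * Q'' ^ 2) + A'' * Q'' / 4)) *
            (Φ * (τ * (ι₁ * lam + ι₂ / (2 * Q'') + ι₃ / (4 * Q'' ^ 2) + A'' * Q'' / 4)) /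
              (1 - Φ * (τ * (ι₁ * lam + ι₂ / (2 * Q'') + ι₃ / (4 * Q'' ^ 2) + A'' * Q'' / 4)))) / (2 * τ * Q'')) →
      ∀ Qe : EngConsts, Qtot * imagTimeWeight β M ^ 2 * B * max 1 (Atot / imagTimeWeight β M) ≤ Qe.CE →
      ∀ p : ℕ, 4 ≤ p → p ≤ D → ∀ (q : Fin (2 * p)) (w : SpaceTimeIdx L M × SectorLeg (sectorCount j)),
        klWtPinnedSum L M β U μ (klFlowFrameU L M β U μ n) j (2 * p) q w ≤ klWtBudget P Qe U j (2 * p)) := by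
  obtain ⟨C₁, C₂, hC₁, hC₂, hro⟩ := readoutWt_ro_le_profile_klEng R c'' hc''.le
  obtain ⟨Cκ, CJ, C₁', C₂', hCκ, hCJ, hC₁', hC₂', hincU⟩ := readoutWt_inc_le_kit_klEng_unif R c'' hc''
  refine ⟨C₁, C₂, Cκ, CJ, C₁', C₂', hC₁, hC₂, hCκ, hCJ, hC₁', hC₂', fun d => ?_⟩
  obtain ⟨Cb, hCb, hinc⟩ := hincU d
  refine ⟨Cb, hCb, fun hR2 => ?_⟩
  obtain ⟨c₃a, hc₃a, U₀a, hU₀a, hro'⟩ := hro hR2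
  obtain ⟨c₃b, hc₃b, U₀b, hU₀b, hinc'⟩ := hinc hR2
  refine ⟨min c₃a c₃b, lt_min hc₃a hc₃b, min U₀a U₀b, lt_min hU₀a hU₀b, ?_⟩
  intro G P Q c hP hc hc6 hc₃' μ hμ U hU hU9 hU₀' hcU β hβmin hβc L M _ _ hL3 hM3 n hn1 hnN hkl hhist hosc hd Kb j hKb1 hKbj hjn hjd D hD3 hD hZ
    B A lam Q' Ab Qb hB hlamB hA hlam hQ hAb hQb Nb hNb0 hcar hlawb hIH κb αb crb ccb hκb hαb hcrb hccb W Z σ τ ψ Φ hW hZ' hσ hτ hψ hΦ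
    A'' Q'' ι₁ ι₂ ι₃ hA'' hQ'' hprof hι₁ hι₂ hι₃ hx₁ hx₂ hx₃ hy hθ Atot Qtot hQtot hAtot Qe hCE p hp hpD q w
  obtain ⟨p', rfl⟩ : ∃ p', p = p' + 1 := ⟨p - 1, by omega⟩
  have he : (0 : ℝ) < klE0 := by norm_num [klE0]
  have hβ : 0 < β := KLRegimeSplit.pos_of_klBetaMin_le hβmin
  have hM0 : (0 : ℝ) < M := Nat.cast_pos.2 (Nat.pos_of_ne_zero (NeZero.ne M))
  have hx : 0 < imagTimeWeight β M := imagTimeWeight_pos_of_pos (M := M) hβ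
  have hK1 : 1 ≤ P.Klam := hP.1
  have hKl : 0 ≤ P.Klam := le_trans zero_le_one hK1
  have hU3g : U ≤ min (klEngU₀3 P R c) (1 / (R.Gfr 3 + 1)) :=
    le_min (hU9.trans (klEngU₀9_le_klEngU₀3 P R c)) (hU9.trans (klEngU₀9_le_inv_gfr_add_one P hR2.wf c (by norm_num)))
  obtain ⟨hc₃a', hc₃b'⟩ : c ≤ c₃a ∧ c ≤ c₃b := le_min_iff.1 hc₃'
  obtain ⟨hU₀a', hU₀b'⟩ : U ≤ U₀a ∧ U ≤ U₀b := le_min_iff.1 hU₀'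
  set K : TrigPolyC4v := klFlowFrameU L M β U μ n with hKdef
  -- constants and names
  have hsq0 : 0 < Real.sqrt (2 * Cκ * klE0) := Real.sqrt_pos.2 (by positivity)
  have hκb0 : 0 < κb := lt_of_lt_of_le hsq0 hκb
  have hαb0 : 0 < αb := lt_of_lt_of_le (by positivity) hαb
  have hcrb0 : 0 < crb := lt_of_lt_of_le (by positivity) hcrb
  have hccb0 : 0 < ccb := lt_of_lt_of_le (by positivity) hccb
  have hW0 : 0 < W := by rw [hW]; positivity
  have hZ0 : 0 < Z := by rw [hZ']; positivity
  have hσ0 : 0 ≤ σ := by rw [hσ]; positivity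
  have hτ0 : 0 < τ := by rw [hτ]; positivity
  have hψ0 : 0 ≤ ψ := by rw [hψ]; positivity
  have hΦ0 : 0 ≤ Φ := by rw [hΦ]; positivity
  -- the measured array at block `K_b` and the sign of the imports
  set μb : ℕ → ℝ := fun m => W * Z ^ m * (klTowerMeasWtAt L M β U μ K d Kb j (2 * m) / klLevUnitF β M 0 m (d * Kb - 1)) with hμb
  have hμb0 : ∀ m, 0 ≤ μb m := fun m => towerMuWt_nonneg hβ U μ K d Kb j m hW0.le hZ0.le
  have hι₁' : μb 1 ≤ ι₁ * lam := hι₁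
  have hι₂' : μb 2 ≤ ι₂ * lam := hι₂
  have hι₃' : μb 3 ≤ ι₃ * lam ^ 2 := hι₃
  have hι₁0 : 0 ≤ ι₁ := (mul_nonneg_iff_of_pos_right hlam).1 ((hμb0 1).trans hι₁')
  have hι₂0 : 0 ≤ ι₂ := (mul_nonneg_iff_of_pos_right hlam).1 ((hμb0 2).trans hι₂')
  have hι₃0 : 0 ≤ ι₃ := (mul_nonneg_iff_of_pos_right (pow_pos hlam 2)).1 ((hμb0 3).trans hι₃')
  -- the public size in floor units splits as `ro + inc`
  have hu : 0 < klLevUnitF β M 0 (p' + 1) j := klLevUnitF_pos hβ 0 (p' + 1) j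
  set pubX : ℝ := klWtPinnedSum L M β U μ K j (2 * (p' + 1)) q w with hpubX
  set roX : ℝ := klWtPinnedSumAt L M β μ K j j (2 * (p' + 1)) (klTowerInput L M β U μ K d Kb) q w with hroX
  set incX : ℝ := klWtPinnedSumAt L M β μ K j j (2 * (p' + 1)) (klEffectiveAction L M β U μ K klE0 j - klTowerInput L M β U μ K d Kb) q w with hincX
  have hsplit : pubX ≤ roX + incX := by
    have hdec : klEffectiveAction L M β U μ K klE0 j = klTowerInput L M β U μ K d Kb + (klEffectiveAction L M β U μ K klE0 j - klTowerInput L M β U μ K d Kb) := by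
      abel
    rw [hpubX, ← klWtPinnedSumOf_klEffectiveAction, ← klWtPinnedSumAt_self, hdec]
    exact klWtPinnedSumAt_add_le hβ.le μ K j j (2 * (p' + 1)) _ _ q w
  -- (ro) the re-measured input under `A_ro λ^{p−1} Q_ro^p`
  have hroB := hro' G P Q c hc hc6 hc₃a' μ hμ U hU hU3g hU₀a' hcU β hβmin hβc L M hL3 hM3 n hn1 hnN hkl hhist hosc d Kb j hd hKb1 hKbj hjn D
    A lam Q' Ab Qb hA hlam.le hQ.le hAb hQb Nb hNb0 hcar hlawb hIH (p' + 1) hp hpD q w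
  -- (inc) the partial increment under `C_inc·D_inc^p·kit(μ̄)` for every truncation `N ≥ 2` under the guard
  have hstep : ∀ N : ℕ, 2 ≤ N → Φ * towerV D τ μb < 1 →
      incX / klLevUnitF β M 0 (p' + 1) j ≤ C₁' / C₂' * (max 1 (C₂' ^ 2)) ^ (p' + 1) *
        (towerFO D σ μb (p' + 1) + ∑ n' ∈ Icc 2 N, exp 1 * Φ ^ (n' - 1) * ψ ^ (p' + 1) * towerS D τ μb n' (p' + 1) +
          ψ ^ (p' + 1) * exp 1 * towerV D τ μb * (Φ * towerV D τ μb) ^ N / (1 - Φ * towerV D τ μb)) := by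
    intro N hN hguard
    rw [hincX]
    exact hinc' G P Q c hP hc hc6 hc₃b' μ hμ U hU hU9 hU₀b' hcU β hβmin hβc L M hL3 hM3 n hn1 hnN hkl hhist hosc hd Kb j hKb1 hKbj hjn hjd D hD hZ
      κb αb crb ccb hκb hαb hcrb hccb W Z σ τ ψ Φ hW hZ' hσ hτ hψ hΦ N (by omega) p' (by omega) hguard q w
  -- E1's part 7 fit and the bracket under one law
  have hCinc : 0 < C₁' / C₂' := by positivity
  have hDinc : 0 < max 1 (C₂' ^ 2) := lt_of_lt_of_le one_pos (le_max_left _ _)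
  have hDinc1 : 1 ≤ max 1 (C₂' ^ 2) := le_max_left _ _
  have hfit := towerReadout_le_of_ro_mul (D := D) (μ := μb) (pub := pubX / klLevUnitF β M 0 (p' + 1) j) (ro := roX / klLevUnitF β M 0 (p' + 1) j)
    (inc := incX / klLevUnitF β M 0 (p' + 1) j) hσ0 hΦ0 hψ0 hτ0 hlam hA'' hQ'' hCinc hDinc hμb0 hι₁' hι₂' hι₃' hprof hx₁ hx₂ hx₃ hy hθ (by omega)
    (by rw [← add_div]; exact div_le_div_of_nonneg_right hsplit hu.le) hroB hstep
  have hX₁ : 0 ≤ 4 * σ * lam * Q'' / (1 - 4 * σ * lam * Q'') := div_nonneg (by positivity) (sub_nonneg.2 hx₁.le)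
  have hY0 : 0 ≤ ι₁ * lam + ι₂ / (2 * Q'') + ι₃ / (4 * Q'' ^ 2) + A'' * Q'' / 4 := by positivity
  have hTY : 0 ≤ τ * (ι₁ * lam + ι₂ / (2 * Q'') + ι₃ / (4 * Q'' ^ 2) + A'' * Q'' / 4) := by positivity
  have hYy : 0 ≤ Φ * (τ * (ι₁ * lam + ι₂ / (2 * Q'') + ι₃ / (4 * Q'' ^ 2) + A'' * Q'' / 4)) /
      (1 - Φ * (τ * (ι₁ * lam + ι₂ / (2 * Q'') + ι₃ / (4 * Q'' ^ 2) + A'' * Q'' / 4))) := div_nonneg (by positivity) (sub_nonneg.2 hy.le)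
  have hAro0 : 0 ≤ C₁ / C₂ * (Ab + A) := by positivity
  have hQro0 : 0 ≤ C₂ ^ 2 * max Q' Qb := by have : 0 ≤ max Q' Qb := le_max_of_le_left hQ.le; positivity
  have hbr := readoutBracket_le_law_mul_sharp (Aro := C₁ / C₂ * (Ab + A)) (Qro := C₂ ^ 2 * max Q' Qb) hAro0 hQro0 hA'' hQ'' hψ0 hτ0 hX₁ hTY hYy
    hCinc.le hDinc1 (by omega : 1 ≤ p' + 1)
  -- the law-shaped bound in floor units
  have hAtot0 : 0 ≤ Atot := by rw [hAtot]; positivity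
  have hQtot0 : 0 ≤ Qtot := by
    rw [hQtot]; exact mul_nonneg hDinc.le (le_trans zero_le_one (le_max_left _ _))
  have hlawX : pubX / klLevUnitF β M 0 (p' + 1) j ≤ Atot * (B * epsCoupling P U j) ^ (p' + 1 - 1) * Qtot ^ (p' + 1) := by
    rw [← hlamB]
    have h1 := hfit.trans (mul_le_mul_of_nonneg_left hbr (pow_nonneg hlam.le _))
    rw [hAtot, hQtot]
    refine h1.trans (le_of_eq ?_)
    ring
  -- the registered weighted budget
  have hfinal := readoutLev_le_levelsRHS (M := M) (P := P) hβ hKl U hAtot0 hQtot0 hB hCE 0 (by omega) j (X := pubX) hlawX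
  rw [show levelGainExp (((0 : Fin 5) : ℕ) + 1) = 0 from rfl, pow_zero, mul_one] at hfinal
  rw [klWtBudget_two_mul_of_two_le P Qe U j (by omega : 2 ≤ p' + 1)]
  exact hfinal

end Summit.HubbardSuperconductivity.HubbardSuperconductivity.Theorems.EngineV8

end
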